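import Summits.Parity.GeneralizedHardyLittlewood.Theses.PrimeLevelFamEdge
import Summits.Parity.GeneralizedHardyLittlewood.Theorems.BeyondDiagonalBeatsQuarter.SecondMainTermFloor

/-!
# Route `PrimeLevelFamEdge`, crux K_B `BeyondDiagonalBeatsQuarter` (stmt-Parity-20343, rev 3): HEART ISOLATION —
# modulo the printed Petersson formula, K_B is ONE inequality on the second off-diagonal main term

K_B (rev 3) reads `FirstMomentPrinted → C′`: given Bettin's printed twisted first moment at prime
level, whatever valid off-diagonal main terms `T₁, T₂` a window `(1, Δ]` beyond the diagonal carries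
(`KMV2000.MomentAsymptotics 1 Δ T₁ T₂`), SOME admissible profile has Cauchy–Schwarz value
`(lin + T₁)²/(2(second + T₂)) > ¼` on SOME sub-window `(a, b) ⊆ [1, Δ]` with `a < 3/2`. Two kernel
facts strip this to its heart: (i) the first correction is PINNED, `T₁ Δ' P 1 = 0` for every
admissible `P` and `1 < Δ' < min Δ 2` (`KMV2000.T₁_apply_one_eq_zero_of_bettin`, Bettin 2017 — the
antecedent); (ii) the Cauchy–Schwarz FLOOR `(lin + T₁)² ≤ second + T₂` (`KMV2000.sq_firstMainTerm_le_
secondMainTerm_of_lt_two`, p524498, from the Petersson formula at prime level: the value never exceeds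
the even share `½`). Hence, GIVEN `PeterssonPrinted` (route item stmt-Parity-20012, already a binder of
`closes`):

  `BeyondDiagonalBeatsQuarter ↔ (FirstMomentPrinted → HEART)`,
  HEART := ∀ Δ > 1, ∀ T₁ T₂, MomentAsymptotics 1 Δ T₁ T₂ → ∃ a b, 1 ≤ a < b ≤ min Δ 2, a < 3/2,
          ∃ P admissible, ∀ Δ' ∈ (a, b): secondMomentForm Δ' P 1 + T₂ Δ' P 1 < 2·(linForm Δ' P 1)²

(`beyondDiagonalBeatsQuarter_iff_heart`; the two directions separately, `→` needing Bettin only).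
HEART is spelled out in the statements (no new definition). The registered stub S2u of the line
`birth` (rev 5) is HEART at the fixed profile `P = X²` (`lin = 2`, `second = 4 + 4/Δ'`: the band
`T₂ Δ' X² 1 < 4(Δ'−1)/Δ'`), so S2u ⇒ HEART (`heart_of_upperSomewhere_X_sq`) ⇒ K_B; the converse
K_B ⇒ S2u is NOT claimed (K_B's witness profile need not be `X²`). This hands the tribunal desk and a
future WAVE-2 the exact statement «K_B ≡ one strict inequality on T₂ for some profile on some
sub-window below 3/2, modulo two printed facts»; the inequality itself (second mollified moment beyond
the diagonal at one prime level, famE-02) is OPEN IN PRINT and not asserted. Standard axioms; no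
Theses statement is asserted. «The programme SEARCHES and TYPES; no claim about Landau–Siegel zeros,
Theorems 1–2 of arXiv:2211.02515 or a repaired Margin232 until a kernel theorem says so.»
-/

namespace Summit.Parity.GeneralizedHardyLittlewood.Theorems.BeyondDiagonalBeatsQuarter

open Polynomial
open Literature.NumberTheory.LFunctions
open Summit.Parity.GeneralizedHardyLittlewood.Theses.PrimeLevelFamEdge

/-- **K_B ⇒ HEART** (Bettin only). If some admissible profile beats `¼` on a sub-window `(a, b) ⊆ [1, Δ]`
with `a < 3/2`, then on `(a, min b 2)` its total second main term is strictly below twice the squared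
linear form: the value inequality forces `second + T₂ > 0` (else the value is `≤ 0`), and `T₁ = 0`
there (`KMV2000.T₁_apply_one_eq_zero_of_bettin`). [cite: Bettin2017, Thm. 1.1]
[cite: KowalskiMichelVanderKam2000, Thm. 6.1 (30)–(32) and §6 p. 19] -/
theorem heart_of_beyondDiagonalBeatsQuarter (hB : BeyondDiagonalBeatsQuarter)
    (hF : FirstMomentPrinted) :
    ∀ Δ : ℝ, 1 < Δ → ∀ T₁ T₂ : ℝ → ℝ[X] → ℝ[X] → ℝ, KMV2000.MomentAsymptotics 1 Δ T₁ T₂ →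
      ∃ a b : ℝ, 1 ≤ a ∧ a < b ∧ b ≤ min Δ 2 ∧ a < 3 / 2 ∧ ∃ P : ℝ[X], KMV2000.Admissible P ∧
        ∀ Δ' : ℝ, a < Δ' → Δ' < b →
          KMV2000.secondMomentForm Δ' P 1 + T₂ Δ' P 1 < 2 * KMV2000.linForm Δ' P 1 ^ 2 := by
  intro Δ hΔ T₁ T₂ hMA
  obtain ⟨a, b, ha, hab, hbΔ, ha32, P, hP, hval⟩ := hB hF Δ hΔ T₁ T₂ hMA
  refine ⟨a, min b 2, ha, lt_min hab (by linarith), ?_, ha32, P, hP, fun Δ' h1' h2' ↦ ?_⟩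
  · exact le_min (le_trans (min_le_left _ _) hbΔ) (min_le_right _ _)
  have h1 : 1 < Δ' := lt_of_le_of_lt ha h1'
  have hΔ'b : Δ' < b := lt_of_lt_of_le h2' (min_le_left _ _)
  have hΔ'2 : Δ' < min Δ 2 :=
    lt_min (lt_of_lt_of_le hΔ'b hbΔ) (lt_of_lt_of_le h2' (min_le_right _ _))
  have hT₁ : T₁ Δ' P 1 = 0 := KMV2000.T₁_apply_one_eq_zero_of_bettin hF hP hMA h1 hΔ'2
  have hv := hval Δ' h1' hΔ'b
  rw [hT₁, add_zero] at hv
  set D : ℝ := KMV2000.secondMomentForm Δ' P 1 + T₂ Δ' P 1 with hD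
  have hDpos : 0 < D := by
    by_contra h
    have h' : KMV2000.linForm Δ' P 1 ^ 2 / (2 * D) ≤ 0 :=
      div_nonpos_of_nonneg_of_nonpos (sq_nonneg _) (by linarith [not_lt.1 h])
    linarith
  rw [lt_div_iff₀ (by positivity)] at hv
  linarith

/-- **HEART ⇒ K_B** (Petersson + Bettin). If for some admissible profile `second + T₂ < 2·lin²` on a
sub-window `(a, b) ⊆ [1, min Δ 2]`, `a < 3/2`, then that profile beats `¼` there: the Cauchy–Schwarz
floor `lin² = (lin + T₁)² ≤ second + T₂` (`T₁ = 0` by Bettin) makes `lin ≠ 0` and the total second main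
term positive, and then `second + T₂ < 2·lin²` is `lin²/(2(second + T₂)) > ¼`.
[cite: KowalskiMichelVanderKam2000, §2 p. 6 and §6 p. 19] [cite: KowalskiMichel2000, §2.3]
[cite: Bettin2017, Thm. 1.1] -/
theorem beyondDiagonalBeatsQuarter_of_heart (hPet : PeterssonPrinted)
    (hH : FirstMomentPrinted →
      ∀ Δ : ℝ, 1 < Δ → ∀ T₁ T₂ : ℝ → ℝ[X] → ℝ[X] → ℝ, KMV2000.MomentAsymptotics 1 Δ T₁ T₂ →
        ∃ a b : ℝ, 1 ≤ a ∧ a < b ∧ b ≤ min Δ 2 ∧ a < 3 / 2 ∧ ∃ P : ℝ[X], KMV2000.Admissible P ∧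
          ∀ Δ' : ℝ, a < Δ' → Δ' < b →
            KMV2000.secondMomentForm Δ' P 1 + T₂ Δ' P 1 < 2 * KMV2000.linForm Δ' P 1 ^ 2) :
    BeyondDiagonalBeatsQuarter := by
  intro hF Δ hΔ T₁ T₂ hMA
  obtain ⟨a, b, ha, hab, hb, ha32, P, hP, hval⟩ := hH hF Δ hΔ T₁ T₂ hMA
  refine ⟨a, b, ha, hab, hb.trans (min_le_left _ _), ha32, P, hP, fun Δ' h1' h2' ↦ ?_⟩
  have h1 : 1 < Δ' := lt_of_le_of_lt ha h1'
  have hΔ'm : Δ' < min Δ 2 := lt_of_lt_of_le h2' hb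
  have hΔ'Δ : Δ' ≤ Δ := (lt_of_lt_of_le hΔ'm (min_le_left _ _)).le
  have hΔ'2 : Δ' < 2 := lt_of_lt_of_le hΔ'm (min_le_right _ _)
  have hT₁ : T₁ Δ' P 1 = 0 := KMV2000.T₁_apply_one_eq_zero_of_bettin hF hP hMA h1 hΔ'm
  have hfloor := KMV2000.sq_firstMainTerm_le_secondMainTerm_of_lt_two hPet hMA hP
    (by linarith) hΔ'2 h1 hΔ'Δ
  have hv := hval Δ' h1' h2'
  rw [hT₁, add_zero] at hfloor ⊢
  have hDpos : 0 < KMV2000.secondMomentForm Δ' P 1 + T₂ Δ' P 1 := by nlinarith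
  rw [lt_div_iff₀ (by positivity)]
  linarith

/-- **HEART ISOLATION.** Modulo the printed Petersson formula at prime level (route item
`PeterssonPrinted`, stmt-Parity-20012), the value crux K_B (rev 3, antecedent `FirstMomentPrinted` =
Bettin 2017 Thm. 1.1) is EQUIVALENT to one strict inequality on the second off-diagonal main term:
for every window and every MA-consistent `(T₁, T₂)`, SOME admissible profile has
`secondMomentForm Δ' P 1 + T₂ Δ' P 1 < 2·(linForm Δ' P 1)²` on SOME sub-window `(a, b) ⊆ [1, min Δ 2]`
with `a < 3/2`. [cite: KowalskiMichelVanderKam2000, §2 p. 6, Thm. 6.1 (30)–(32), §6 p. 19]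
[cite: KowalskiMichel2000, §2.3] [cite: Bettin2017, Thm. 1.1] -/
theorem beyondDiagonalBeatsQuarter_iff_heart (hPet : PeterssonPrinted) :
    BeyondDiagonalBeatsQuarter ↔
      (FirstMomentPrinted →
        ∀ Δ : ℝ, 1 < Δ → ∀ T₁ T₂ : ℝ → ℝ[X] → ℝ[X] → ℝ, KMV2000.MomentAsymptotics 1 Δ T₁ T₂ →
          ∃ a b : ℝ, 1 ≤ a ∧ a < b ∧ b ≤ min Δ 2 ∧ a < 3 / 2 ∧ ∃ P : ℝ[X], KMV2000.Admissible P ∧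
            ∀ Δ' : ℝ, a < Δ' → Δ' < b →
              KMV2000.secondMomentForm Δ' P 1 + T₂ Δ' P 1 < 2 * KMV2000.linForm Δ' P 1 ^ 2) :=
  ⟨fun hB hF ↦ heart_of_beyondDiagonalBeatsQuarter hB hF,
    fun hH ↦ beyondDiagonalBeatsQuarter_of_heart hPet hH⟩

/-- **The registered stub S2u implies the HEART** (take `P = X²`, `KMV2000.admissible_X_sq`): the line
`birth` (rev 5) proves K_B from S2u through `beyondDiagonalBeatsQuarter_of_heart`; the converse
(K_B ⇒ S2u) is not claimed — K_B's witness profile need not be `X²`.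
[cite: KowalskiMichelVanderKam2000, Thm. 6.1 (30)–(32)] -/
theorem heart_of_upperSomewhere_X_sq
    (hU : ∀ Δ : ℝ, 1 < Δ → ∀ T₁ T₂ : ℝ → ℝ[X] → ℝ[X] → ℝ, KMV2000.MomentAsymptotics 1 Δ T₁ T₂ →
      ∃ a b : ℝ, 1 ≤ a ∧ a < b ∧ b ≤ min Δ 2 ∧ a < 3 / 2 ∧ ∀ Δ' : ℝ, a < Δ' → Δ' < b →
        KMV2000.secondMomentForm Δ' (X ^ 2) 1 + T₂ Δ' (X ^ 2) 1 <
          2 * KMV2000.linForm Δ' (X ^ 2) 1 ^ 2) :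
    ∀ Δ : ℝ, 1 < Δ → ∀ T₁ T₂ : ℝ → ℝ[X] → ℝ[X] → ℝ, KMV2000.MomentAsymptotics 1 Δ T₁ T₂ →
      ∃ a b : ℝ, 1 ≤ a ∧ a < b ∧ b ≤ min Δ 2 ∧ a < 3 / 2 ∧ ∃ P : ℝ[X], KMV2000.Admissible P ∧
        ∀ Δ' : ℝ, a < Δ' → Δ' < b →
          KMV2000.secondMomentForm Δ' P 1 + T₂ Δ' P 1 < 2 * KMV2000.linForm Δ' P 1 ^ 2 := by
  intro Δ hΔ T₁ T₂ hMA
  obtain ⟨a, b, ha, hab, hb, ha32, hval⟩ := hU Δ hΔ T₁ T₂ hMA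
  exact ⟨a, b, ha, hab, hb, ha32, X ^ 2, KMV2000.admissible_X_sq, hval⟩

/-- **S2u ⇒ K_B on the Theorems side** (Petersson displayed): the composition the rev-5 skeleton
performs, as one implication — whatever proves the registered stub S2u closes K_B given the printed
Petersson formula. [cite: KowalskiMichelVanderKam2000, Thm. 6.1 (30)–(32), §6 p. 19]
[cite: KowalskiMichel2000, §2.3] -/
theorem beyondDiagonalBeatsQuarter_of_upperSomewhere_X_sq (hPet : PeterssonPrinted)
    (hU : ∀ Δ : ℝ, 1 < Δ → ∀ T₁ T₂ : ℝ → ℝ[X] → ℝ[X] → ℝ, KMV2000.MomentAsymptotics 1 Δ T₁ T₂ →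
      ∃ a b : ℝ, 1 ≤ a ∧ a < b ∧ b ≤ min Δ 2 ∧ a < 3 / 2 ∧ ∀ Δ' : ℝ, a < Δ' → Δ' < b →
        KMV2000.secondMomentForm Δ' (X ^ 2) 1 + T₂ Δ' (X ^ 2) 1 <
          2 * KMV2000.linForm Δ' (X ^ 2) 1 ^ 2) :
    BeyondDiagonalBeatsQuarter :=
  beyondDiagonalBeatsQuarter_of_heart hPet fun _ ↦ heart_of_upperSomewhere_X_sq hU

end Summit.Parity.GeneralizedHardyLittlewood.Theorems.BeyondDiagonalBeatsQuarter
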